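import Summits.ValiantsHypothesis.ValiantsHypothesis.Theorems.BarrierLeverPartitionMinorsChowTwinSplitsPredicate

/-!
# Route BarrierLever — Chow witnesses for partition minors (item 20172, CPM): the TWIN-LOCKED core
# engine (locked ∧ twin-locked ∧ unpeelable cores suffice)

Helper file (`--supports stmt-ValiantsHypothesis-20172`; cell valiant-natproofs, rung V4, 𝒟-side of
door (c); seat valiant-natproofs-prover gen 13).  Closes NO item; definition-free.

The core engine `chow_hit_of_core` (val-np-p4 g11) reduces item 20172 to CORE layouts: injective,
LOCKED (no literal class of the rows has the size of a literal class of the columns) and UNPEELABLE.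
For a coordinate `a`, the `a`-TWIN BOTTOMS of a row family `u` are the indices `i` with
`a ∉ u i` whose top `insert a (u i)` is also a row; write `tb_a(u)` for their number (so `u ↦ u \ a` is
injective iff `tb_a(u) = 0`).

This file adds the three TWIN reductions in predicate form (`…ChowTwinSplitsPredicate`:
`chow_twinBalancedSplit_of_card_eq` — `tb_a(u) = tb_c(w)`; `chow_twinSplit_of_card_eq` —
`tb_a(u) = #{j : c ∈ w j}` (val-np-p2 g7's twin split); `chow_twinSplit_of_card_eq'` — the transpose)
to the engine:
* `chow_hit_of_twinLockedCore` — **TWIN-LOCKED CORE ENGINE**: if every injective layout that is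
  locked, unpeelable, TWIN-LOCKED (for all `a, c`: `tb_a(u) ≠ tb_c(w)`, `tb_a(u) ≠ #{j : c ∈ w j}`,
  `#{i : a ∈ u i} ≠ tb_c(w)`) and of size `r ≥ h + 1` is hit, then every injective layout is hit.
  (Twin-locked implies unpeelable — a peelable pair has `tb_a(u) = tb_c(w) = 0` — the clause is kept
  so that cores of this engine are cores of `chow_hit_of_core`.)  With the literal splits this is the
  complete list of «corner» reductions of one decoupled coordinate pair (memo §0.2): a twin-locked
  core is a layout on which EVERY product-with-a-private-pair design is singular at order zero.
* `exists_twinLockedCore_of_not_hit` — the contrapositive: a minimal missed layout is locked,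
  unpeelable, twin-locked and has `r ≥ h + 1`.

Census of the gain (seat folder lab/rulesets.py, exact rule solver; memo
HOME/prover/gen13/MEMO-slots-corners-g13.md §0.2): at `h = 4`, 6 000 random layouts, the reductions
{peel, pairSplit, pairSplit_mixed, twinSplit} leave 40 irreducible, adding the twin-balanced split 37;
sizes `r ∈ {6, 7}`: 11 → 7; at `h = 3` the 224 irreducible layouts (all `r = 4`, star type) are unchanged.

WHAT THIS IS NOT: an organising principle for finite checks; nothing on items 20172 / 20195 / 19717
themselves, on crux stmt-ValiantsHypothesis-14610, or on `VP` versus `VNP`.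
-/

set_option linter.dupNamespace false

namespace Summit.ValiantsHypothesis.ValiantsHypothesis.Theorems.BarrierLever.ChowFactor

open Finset MvPolynomial
open Summit.ValiantsHypothesis.ValiantsHypothesis.Theorems.BarrierLever.Compression
  (exists_blockPerm)

noncomputable section

variable {h : ℕ}

/-! ## 1. The twin-locked core engine -/

/-- **TWIN-LOCKED CORE ENGINE.**  If every injective layout `(u, w)` (height `h`, size `r`) that is
LOCKED, UNPEELABLE, TWIN-LOCKED (`tb_a(u) ≠ tb_c(w)` for all `a, c`) and has `h + 1 ≤ r` is hit by a
product of `h + h` affine forms, then every injective layout is hit. -/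
theorem chow_hit_of_twinLockedCore
    (core : ∀ (h r : ℕ) (u w : Fin r → Finset (Fin h)), Function.Injective u → Function.Injective w →
      (∀ (a c : Fin h) (β γ : Bool),
        (Finset.univ.filter fun i => (a ∈ u i ↔ β = true)).card ≠
          (Finset.univ.filter fun j => (c ∈ w j ↔ γ = true)).card) →
      (∀ a c : Fin h, ¬ (Function.Injective (fun i => (u i).erase a) ∧
        Function.Injective (fun j => (w j).erase c))) →
      (∀ a c : Fin h, (Finset.univ.filter fun i => a ∉ u i ∧ ∃ i', u i' = insert a (u i)).card ≠
        (Finset.univ.filter fun j => c ∉ w j ∧ ∃ j', w j' = insert c (w j)).card) →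
      (∀ a c : Fin h, (Finset.univ.filter fun i => a ∉ u i ∧ ∃ i', u i' = insert a (u i)).card ≠
        (Finset.univ.filter fun j => c ∈ w j).card) →
      (∀ a c : Fin h, (Finset.univ.filter fun i => a ∈ u i).card ≠
        (Finset.univ.filter fun j => c ∉ w j ∧ ∃ j', w j' = insert c (w j)).card) →
      h + 1 ≤ r →
      ∃ ℓ : Fin (h + h) → MvPolynomial (Fin (h + h)) ℂ, (∀ q, (ℓ q).totalDegree ≤ 1) ∧
        (Matrix.of fun i j : Fin r => coeff
          (∑ b ∈ u i, Finsupp.single (Fin.castAdd h b) 1 + ∑ d ∈ w j, Finsupp.single (Fin.natAdd h d) 1)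
          (∏ q, ℓ q)).det ≠ 0)
    (h r : ℕ) (u w : Fin r → Finset (Fin h)) (hu : Function.Injective u)
    (hw : Function.Injective w) :
    ∃ ℓ : Fin (h + h) → MvPolynomial (Fin (h + h)) ℂ, (∀ q, (ℓ q).totalDegree ≤ 1) ∧
      (Matrix.of fun i j : Fin r => coeff
        (∑ b ∈ u i, Finsupp.single (Fin.castAdd h b) 1 + ∑ d ∈ w j, Finsupp.single (Fin.natAdd h d) 1)
        (∏ q, ℓ q)).det ≠ 0 := by
  classical
  induction h generalizing r with
  | zero => exact chow_hit_height_zero r u w hu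
  | succ h ih =>
    -- twin-balanced split first (it subsumes the peel)
    by_cases htb : ∃ a c : Fin (h + 1),
        (Finset.univ.filter fun i => a ∉ u i ∧ ∃ i', u i' = insert a (u i)).card =
          (Finset.univ.filter fun j => c ∉ w j ∧ ∃ j', w j' = insert c (w j)).card
    · obtain ⟨a, c, hac⟩ := htb
      exact chow_twinBalancedSplit_of_card_eq a c u w hu hw hac ih
    push Not at htb
    by_cases hts : ∃ a c : Fin (h + 1),
        (Finset.univ.filter fun i => a ∉ u i ∧ ∃ i', u i' = insert a (u i)).card =
          (Finset.univ.filter fun j => c ∈ w j).card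
    · obtain ⟨a, c, hac⟩ := hts
      exact chow_twinSplit_of_card_eq a c u w hu hw hac ih
    push Not at hts
    by_cases hts' : ∃ a c : Fin (h + 1),
        (Finset.univ.filter fun i => a ∈ u i).card =
          (Finset.univ.filter fun j => c ∉ w j ∧ ∃ j', w j' = insert c (w j)).card
    · obtain ⟨a, c, hac⟩ := hts'
      exact chow_twinSplit_of_card_eq' a c u w hu hw hac ih
    push Not at hts'
    -- unpeelable (a peelable pair has `0 = 0` twin bottoms)
    have hpeel' : ∀ a c : Fin (h + 1), ¬ (Function.Injective (fun i => (u i).erase a) ∧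
        Function.Injective (fun j => (w j).erase c)) := by
      intro a c hac
      apply htb a c
      rw [twinBottoms_eq_empty_of_injective u a hac.1, twinBottoms_eq_empty_of_injective w c hac.2]
    -- the support bound for an unpeelable side
    have hsize : h + 1 + 1 ≤ r := by
      by_cases hrow : ∀ a : Fin (h + 1),
          (Finset.univ.filter fun i => a ∉ u i ∧ ∃ i', u i' = insert a (u i)) ≠ ∅
      · exact succ_le_of_unpeelable u (Nat.succ_pos h)
          (fun a => exists_erase_eq_of_twinBottoms_nonempty u a (hrow a))
      · push Not at hrow
        obtain ⟨a, ha⟩ := hrow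
        refine succ_le_of_unpeelable w (Nat.succ_pos h) (fun c => ?_)
        refine exists_erase_eq_of_twinBottoms_nonempty w c (fun hc => htb a c ?_)
        rw [ha, hc]
    -- locked: core; unlocked: literal split (verbatim the core engine)
    by_cases hlk : ∀ (a c : Fin (h + 1)) (β γ : Bool),
        (Finset.univ.filter fun i => (a ∈ u i ↔ β = true)).card ≠
          (Finset.univ.filter fun j => (c ∈ w j ↔ γ = true)).card
    · exact core (h + 1) r u w hu hw hlk hpeel' htb hts hts' hsize
    push Not at hlk
    obtain ⟨a, c, β, γ, hk⟩ := hlk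
    rw [card_filter_iff_eq, card_filter_iff_eq] at hk
    have hua := card_filter_mem_add_card_filter_not_mem u a
    have hwc := card_filter_mem_add_card_filter_not_mem w c
    have key : (Finset.univ.filter fun i => a ∉ u i).card = (Finset.univ.filter fun j => c ∉ w j).card ∨
        (Finset.univ.filter fun i => a ∉ u i).card = (Finset.univ.filter fun j => c ∈ w j).card := by
      cases β <;> cases γ <;> simp only [Bool.false_eq_true, if_false, if_true] at hk <;> omega
    obtain ⟨k₀, hk₀⟩ : ∃ k₀, (Finset.univ.filter fun i => a ∉ u i).card = k₀ := ⟨_, rfl⟩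
    rw [hk₀] at key hua
    obtain ⟨m, hkm⟩ : ∃ m, r = k₀ + m := ⟨r - k₀, by omega⟩
    subst hkm
    obtain ⟨σ, hσ1, hσ2⟩ := exists_blockPerm (Finset.univ.filter fun i => a ∉ u i) hk₀
    have hu0 : ∀ i : Fin k₀, a ∉ u (σ (Fin.castAdd m i)) := fun i => by
      have := hσ1 i
      rw [Finset.mem_filter] at this
      exact this.2
    have hu1 : ∀ i : Fin m, a ∈ u (σ (Fin.natAdd k₀ i)) := fun i => by
      have := hσ2 i
      rw [Finset.mem_filter] at this
      by_contra hna
      exact this ⟨Finset.mem_univ _, hna⟩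
    have hU0 := preimage_succAbove_injective_of_not_mem a (fun i => u (σ (Fin.castAdd m i)))
      (fun i j hij => Fin.castAdd_injective _ _ (σ.injective (hu hij))) hu0
    have hU1 := preimage_succAbove_injective_of_mem a (fun i => u (σ (Fin.natAdd k₀ i)))
      (fun i j hij => Fin.natAdd_injective _ _ (σ.injective (hu hij))) hu1
    rcases key with hkk | hkk
    · obtain ⟨τ, hτ1, hτ2⟩ := exists_blockPerm (Finset.univ.filter fun j => c ∉ w j) hkk.symm
      have hw0 : ∀ j : Fin k₀, c ∉ w (τ (Fin.castAdd m j)) := fun j => by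
        have := hτ1 j
        rw [Finset.mem_filter] at this
        exact this.2
      have hw1 : ∀ j : Fin m, c ∈ w (τ (Fin.natAdd k₀ j)) := fun j => by
        have := hτ2 j
        rw [Finset.mem_filter] at this
        by_contra hnc
        exact this ⟨Finset.mem_univ _, hnc⟩
      have hW0 := preimage_succAbove_injective_of_not_mem c (fun j => w (τ (Fin.castAdd m j)))
        (fun i j hij => Fin.castAdd_injective _ _ (τ.injective (hw hij))) hw0
      have hW1 := preimage_succAbove_injective_of_mem c (fun j => w (τ (Fin.natAdd k₀ j)))
        (fun i j hij => Fin.natAdd_injective _ _ (τ.injective (hw hij))) hw1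
      exact chow_hit_of_perm u w σ τ (chow_pairSplit a c (fun i => u (σ i)) (fun j => w (τ j))
        hu0 hu1 hw0 hw1 (ih k₀ _ _ hU0 hW0) (ih m _ _ hU1 hW1))
    · obtain ⟨τ, hτ1, hτ2⟩ := exists_blockPerm (Finset.univ.filter fun j => c ∈ w j) hkk.symm
      have hw0 : ∀ j : Fin k₀, c ∈ w (τ (Fin.castAdd m j)) := fun j => by
        have := hτ1 j
        rw [Finset.mem_filter] at this
        exact this.2
      have hw1 : ∀ j : Fin m, c ∉ w (τ (Fin.natAdd k₀ j)) := fun j => by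
        have := hτ2 j
        rw [Finset.mem_filter] at this
        intro hc
        exact this ⟨Finset.mem_univ _, hc⟩
      have hW0 := preimage_succAbove_injective_of_mem c (fun j => w (τ (Fin.castAdd m j)))
        (fun i j hij => Fin.castAdd_injective _ _ (τ.injective (hw hij))) hw0
      have hW1 := preimage_succAbove_injective_of_not_mem c (fun j => w (τ (Fin.natAdd k₀ j)))
        (fun i j hij => Fin.natAdd_injective _ _ (τ.injective (hw hij))) hw1
      exact chow_hit_of_perm u w σ τ (chow_pairSplit_mixed a c (fun i => u (σ i)) (fun j => w (τ j))
        hu0 hu1 hw0 hw1 (ih k₀ _ _ hU0 hW0) (ih m _ _ hU1 hW1))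

/-- **Contrapositive: the structure of a minimal missed layout.**  If some injective layout is NOT
hit, then some injective layout that is locked, unpeelable, TWIN-LOCKED and of size `r ≥ h + 1` is not
hit either. -/
theorem exists_twinLockedCore_of_not_hit {h r : ℕ} (u w : Fin r → Finset (Fin h))
    (hu : Function.Injective u) (hw : Function.Injective w)
    (hnot : ¬ ∃ ℓ : Fin (h + h) → MvPolynomial (Fin (h + h)) ℂ, (∀ q, (ℓ q).totalDegree ≤ 1) ∧
      (Matrix.of fun i j : Fin r => coeff
        (∑ b ∈ u i, Finsupp.single (Fin.castAdd h b) 1 + ∑ d ∈ w j, Finsupp.single (Fin.natAdd h d) 1)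
        (∏ q, ℓ q)).det ≠ 0) :
    ∃ (h' r' : ℕ) (u' w' : Fin r' → Finset (Fin h')), Function.Injective u' ∧ Function.Injective w' ∧
      (∀ (a c : Fin h') (β γ : Bool),
        (Finset.univ.filter fun i => (a ∈ u' i ↔ β = true)).card ≠
          (Finset.univ.filter fun j => (c ∈ w' j ↔ γ = true)).card) ∧
      (∀ a c : Fin h', ¬ (Function.Injective (fun i => (u' i).erase a) ∧
        Function.Injective (fun j => (w' j).erase c))) ∧
      (∀ a c : Fin h', (Finset.univ.filter fun i => a ∉ u' i ∧ ∃ i', u' i' = insert a (u' i)).card ≠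
        (Finset.univ.filter fun j => c ∉ w' j ∧ ∃ j', w' j' = insert c (w' j)).card) ∧
      (∀ a c : Fin h', (Finset.univ.filter fun i => a ∉ u' i ∧ ∃ i', u' i' = insert a (u' i)).card ≠
        (Finset.univ.filter fun j => c ∈ w' j).card) ∧
      (∀ a c : Fin h', (Finset.univ.filter fun i => a ∈ u' i).card ≠
        (Finset.univ.filter fun j => c ∉ w' j ∧ ∃ j', w' j' = insert c (w' j)).card) ∧
      h' + 1 ≤ r' ∧
      ¬ ∃ ℓ : Fin (h' + h') → MvPolynomial (Fin (h' + h')) ℂ, (∀ q, (ℓ q).totalDegree ≤ 1) ∧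
        (Matrix.of fun i j : Fin r' => coeff
          (∑ b ∈ u' i, Finsupp.single (Fin.castAdd h' b) 1 + ∑ d ∈ w' j, Finsupp.single (Fin.natAdd h' d) 1)
          (∏ q, ℓ q)).det ≠ 0 := by
  by_contra hall
  push Not at hall
  exact hnot (chow_hit_of_twinLockedCore
    (fun h r u w hu hw hlk hpl htw hts hts' hsz =>
      hall h r u w hu hw hlk (fun a c h1 h2 => hpl a c ⟨h1, h2⟩) htw hts hts' hsz)
    h r u w hu hw)

end

end Summit.ValiantsHypothesis.ValiantsHypothesis.Theorems.BarrierLever.ChowFactor
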